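import Literature.AlgebraicGeometry.AbelianSchemes.AbelianSchemeFibreAlongIntegralPoint   -- ★ `left_geomReductionMap_comp_fst`, `left_specFractionFieldι_comp_extendPoint_modelPointsEquiv_symm`
import HarnessLib

/-!
# Affine readings of the reduction map: two geometric points with the same generic reading in `Spec C` have reductions with the same
# special reading in `Spec C` (organ (GS-3d)-READING of the `stub_INJ0` payer)

Topic `AlgebraicGeometry/Motives`; namespace `Literature.AlgebraicGeometry.Motives.IntegralModel`.  THEOREMS ONLY (no definition, no instance, no notation, no
named fact, no `sorry`).  Cell `hodgecm-mathlib` (D-0151), P6 «MOD programme» (crux hLiu418 = stmt-HodgeConjecture-24832, `--supports`, count-neutral); P-LINE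
ED. 2 leaf `Lines/F0_P6a_PELSpread.lean`, socket `stub_INJ0` (LEAD F0P6-plan (g3) «M-55b» (2) STAGE CUT; A-p14 (g35) dossier step 3 «READING»; LA4-plan (g0)
DEAL v3 «LA4-p03 = INJ0 assembly owner», gap G4 of LA4-p03՚s census).  HC_CM is proved only modulo the printed citations until rung 0 closes; nothing here is
about HC.

THE MATHEMATICS ([SerreTate1968] §1 (reduction of points via the valuative criterion); [Hartshorne1977] II Thm. 4.7, II Prop. 2.3 (`Hom(Spec R, Spec C) =
Hom(C, R)`)).  For a proper model `𝓨` over `𝒪_{K,(v)}` of `Y∕K`, a geometric point `x ∈ Y(Ω̄_v)` extends uniquely to an `𝒪̄`-point `x̃` of `𝓨`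
(`𝒪̄ ⊂ Ω̄_v` the valuation ring, ★ `extendPoint`), whose closed point is the reduction `red x ∈ 𝓨_s(κ̄(v))` (★ `geomReductionMap`,
★ `left_geomReductionMap_comp_fst`) and whose generic point is `x` read in `𝓨` (★ `left_specFractionFieldι_comp_extendPoint_modelPointsEquiv_symm`).
Hence for every morphism `f : 𝓨 → Spec C` to an AFFINE scheme: if the generic readings `x₁ ≫ ι_η ≫ f = x₂ ≫ ι_η ≫ f` agree, then `x̃₁ ≫ f = x̃₂ ≫ f`
(a morphism `Spec 𝒪̄ → Spec C` is a ring map `C → 𝒪̄`, determined after the injection `𝒪̄ ↪ Ω̄`), and therefore the SPECIAL readings agree: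
`(red x₁) ≫ ι_s ≫ f = (red x₂) ≫ ι_s ≫ f`.  USE (`stub_INJ0`): `f :=` localisation leg ≫ sheet structure `q : stage → Spec 𝓞 Fᵢ` (★ GS-3a); two record points
read on the SAME sheet `e` have the same generic `q`-reading (`Spec e`), so their reductions `red₀Of … e yᵢ` have the same special `q`-reading — the
«same `q`-composite» hypothesis of the cofinite passage ★ (GS-3) ∕ ★ (GS-3d).

* `specMap_algebraMap_comp_eq_iff` — `Spec 𝒪̄ → Spec C` morphisms agreeing on `Spec Ω̄` are equal (`𝒪̄ ↪ Ω̄` injective).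
* `extendPoint_left_comp_eq_of_generic` — equal generic affine readings ⇒ equal affine readings of the `𝒪̄`-extensions.
* `geomReductionMap_left_comp_fst_comp_eq_of_generic` — THE HEAD: equal generic affine readings ⇒ equal special affine readings of the reductions.

## References
* [SerreTate1968] J.-P. Serre, J. Tate, *Good reduction of abelian varieties*, Ann. of Math. 88 (1968), §1.
* [Hartshorne1977] R. Hartshorne, *Algebraic Geometry* (1977), II Prop. 2.3, II Thm. 4.7.
-/

set_option autoImplicit false

noncomputable section

-- Mathlib's `Over`/pull-back API is stated across semireducible wrappers (as in the ★ `Motives/IntegralModel*` files).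
set_option backward.isDefEq.respectTransparency false

open CategoryTheory CategoryTheory.Limits AlgebraicGeometry

namespace Literature.AlgebraicGeometry.Motives

open IsDedekindDomain IsDedekindDomain.HeightOneSpectrum
open scoped NumberField
open Literature.NumberTheory.EllipticCurves (genericFibre specGenericPoint)
open Literature.NumberTheory.GaloisRepresentations (closureValuationSubring)
open Literature.NumberTheory.DiophantineGeometry

/-! ### §1 Morphisms `Spec R → Spec C` are determined on `Spec (Frac R)` for a domain `R ⊆ Ω` -/

/-- **Two morphisms `Spec R ⟶ Spec C` that agree after `Spec Ω → Spec R` are equal** when `R → Ω` is injective: `Spec` is fully faithful and an injective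
ring map is a monomorphism of rings. [cite: Hartshorne1977, II Prop. 2.3] -/
theorem specMap_algebraMap_comp_eq_iff {R Ω : Type} [CommRing R] [CommRing Ω] [Algebra R Ω] (hinj : Function.Injective (algebraMap R Ω))
    {C : CommRingCat.{0}} (g₁ g₂ : Spec (.of R) ⟶ Spec C) :
    Spec.map (CommRingCat.ofHom (algebraMap R Ω)) ≫ g₁ = Spec.map (CommRingCat.ofHom (algebraMap R Ω)) ≫ g₂ ↔ g₁ = g₂ := by
  refine ⟨fun h => ?_, fun h => by rw [h]⟩
  obtain ⟨φ₁, rfl⟩ := Spec.map_surjective g₁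
  obtain ⟨φ₂, rfl⟩ := Spec.map_surjective g₂
  rw [← Spec.map_comp, ← Spec.map_comp, Spec.map_inj] at h
  haveI : Mono (CommRingCat.ofHom (algebraMap R Ω)) := ConcreteCategory.mono_of_injective _ hinj
  rw [cancel_mono] at h
  rw [h]

/-! ### §2 Equal generic affine readings ⇒ equal affine readings of the extensions and of the reductions -/

namespace IntegralModel

variable {K : Type} [Field K] [NumberField K] {v : HeightOneSpectrum (𝓞 K)} {Y : SchemeOver K}
  (𝓨 : IntegralModel (valuationSubringAtPrime K v) K Y)

/-- **Equal generic readings in an affine scheme ⇒ the `𝒪̄`-extensions have equal readings**: for `f : 𝓨 → Spec C` and geometric points `x₁, x₂ ∈ Y(Ω̄_v)`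
with `x₁ ≫ ι_η ≫ f = x₂ ≫ ι_η ≫ f`, the extensions `x̃ᵢ = extendPoint (modelPointsEquiv⁻¹ xᵢ)` satisfy `x̃₁ ≫ f = x̃₂ ≫ f` (§1 with the generic point equality
★ `left_specFractionFieldι_comp_extendPoint_modelPointsEquiv_symm`). [cite: SerreTate1968, §1] [cite: Hartshorne1977, II Thm. 4.7] -/
theorem extendPoint_left_comp_eq_of_generic [IsProper 𝓨.total.hom] {C : CommRingCat.{0}} (f : 𝓨.total.left ⟶ Spec C)
    (x₁ x₂ : AlgPoints Y (AlgebraicClosure (v.adicCompletion K)))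
    (h : (x₁.left ≫ 𝓨.genericIso'.inv.left ≫ pullback.fst 𝓨.total.hom (specGenericPoint (valuationSubringAtPrime K v) K)) ≫ f =
      (x₂.left ≫ 𝓨.genericIso'.inv.left ≫ pullback.fst 𝓨.total.hom (specGenericPoint (valuationSubringAtPrime K v) K)) ≫ f) :
    (extendPoint (closureValuationSubring (v.adicCompletion K)) (toClosureValuationSubring v) 𝓨.total (𝓨.modelPointsEquiv.symm x₁)).left ≫ f =
      (extendPoint (closureValuationSubring (v.adicCompletion K)) (toClosureValuationSubring v) 𝓨.total (𝓨.modelPointsEquiv.symm x₂)).left ≫ f := by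
  rw [← left_specFractionFieldι_comp_extendPoint_modelPointsEquiv_symm 𝓨 x₁, ← left_specFractionFieldι_comp_extendPoint_modelPointsEquiv_symm 𝓨 x₂,
    Category.assoc, Category.assoc] at h
  exact (specMap_algebraMap_comp_eq_iff (R := ↥(closureValuationSubring (v.adicCompletion K))) (Ω := AlgebraicClosure (v.adicCompletion K))
    Subtype.val_injective _ _).mp h

/-- **THE HEAD — equal generic affine readings ⇒ equal special affine readings of the reductions**: with `f : 𝓨 → Spec C` and
`x₁ ≫ ι_η ≫ f = x₂ ≫ ι_η ≫ f`, the reductions satisfy `(red x₁) ≫ ι_s ≫ f = (red x₂) ≫ ι_s ≫ f` (`ι_s = pr₁ : 𝓨_s → 𝓨`; ★ `left_geomReductionMap_comp_fst` +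
§2). [cite: SerreTate1968, §1] [cite: Hartshorne1977, II Thm. 4.7] -/
theorem geomReductionMap_left_comp_fst_comp_eq_of_generic [IsProper 𝓨.total.hom] {C : CommRingCat.{0}} (f : 𝓨.total.left ⟶ Spec C)
    (x₁ x₂ : AlgPoints Y (AlgebraicClosure (v.adicCompletion K)))
    (h : (x₁.left ≫ 𝓨.genericIso'.inv.left ≫ pullback.fst 𝓨.total.hom (specGenericPoint (valuationSubringAtPrime K v) K)) ≫ f =
      (x₂.left ≫ 𝓨.genericIso'.inv.left ≫ pullback.fst 𝓨.total.hom (specGenericPoint (valuationSubringAtPrime K v) K)) ≫ f) :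
    ((𝓨.geomReductionMap x₁).left ≫ pullback.fst 𝓨.total.hom (specResidueField v)) ≫ f =
      ((𝓨.geomReductionMap x₂).left ≫ pullback.fst 𝓨.total.hom (specResidueField v)) ≫ f := by
  rw [left_geomReductionMap_comp_fst, left_geomReductionMap_comp_fst, Category.assoc, Category.assoc, Category.assoc, Category.assoc,
    extendPoint_left_comp_eq_of_generic 𝓨 f x₁ x₂ h]

end IntegralModel

end Literature.AlgebraicGeometry.Motives

end
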